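import Summits.AnomalousDissipation.AnomalousDissipation.Theorems.SolenoidalFractalHomogenisationLagrangianCarrierConstructionTowerStep
import Summits.AnomalousDissipation.AnomalousDissipation.Theorems.SolenoidalFractalHomogenisationLagrangianCarrierConstructionTowerSmooth
import HarnessLib

/-!
# K3L `LagrangianCarrierConstruction` (stmt-AnomalousDissipation-24913), line `birth`, stub `stub_flowsL`:
# the inductive step of the Lagrangian tower at every order of smoothness (helper; `--supports stmt-AnomalousDissipation-24913`)

Summits-side helper file (everything proved; no definitions, no named facts). `tower_step_smooth` is `…TowerStep.tower_step` with the
smoothness clauses of the tower invariant quantified over ALL finite orders `n ≥ 1` (one-sided joint `C^n` slabs of the absolute flow and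
of its inverses at every time; two-sided ones off the countable break set, which now also collects, for every order, the times around which
the Eulerian field has no two-sided `C^n` slab): the SAME next absolute flow `A'` is produced for all orders, so that its slices are `C^∞`
(`Torus.IsSmooth` after descent) — what the per-level regularity package `LevelRegular` of the re-registered `stub_flowsL` asks. The
flow equation, the inserted velocity and the derivative bounds are those of order one. Infrastructure for the construction side of route-1's
rung leaf F-D1.A0 (a frontier formal rung); NOT a proof of anomalous dissipation.
-/

set_option linter.dupNamespace false

noncomputable section

namespace Summit.AnomalousDissipation.AnomalousDissipation.Theorems.SolenoidalFractalHomogenisation.LagrangianCarrierConstruction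

open Set Function Filter Topology Metric
open scoped NNReal
open Literature.Analysis.ODE Literature.Analysis.FunctionSpaces

section Step

variable {d : Type*} [Fintype d] [DecidableEq d]

/-- **The inductive step of the Lagrangian tower, at every order of smoothness** (see the module docstring). [cite: ArmstrongVicol2025, §2.2 (PDF pp. 12, 18: the Lagrangian flows X_m and the insertion on refresh windows)] -/
theorem tower_step_smooth
    (A : ℝ → EuclideanSpace ℝ d ≃ EuclideanSpace ℝ d) (B : ℝ → EuclideanSpace ℝ d → EuclideanSpace ℝ d) (D : Set ℝ)
    (h1 : ∀ t z (k : d → ℤ), A t (z + Torus.latticeVec k) = A t z + Torus.latticeVec k)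
    (h3 : ∀ (n : ℕ), 1 ≤ n → ∀ r, ∃ ε > 0, ContDiffOn ℝ n (fun p : ℝ × EuclideanSpace ℝ d => A p.1 p.2) (Icc r (r + ε) ×ˢ univ) ∧
      ContDiffOn ℝ n (fun p : ℝ × EuclideanSpace ℝ d => A p.1 p.2) (Icc (r - ε) r ×ˢ univ))
    (h3' : ∀ (n : ℕ), 1 ≤ n → ∀ r, ∃ ε > 0, ContDiffOn ℝ n (fun p : ℝ × EuclideanSpace ℝ d => (A p.1).symm p.2) (Icc r (r + ε) ×ˢ univ) ∧
      ContDiffOn ℝ n (fun p : ℝ × EuclideanSpace ℝ d => (A p.1).symm p.2) (Icc (r - ε) r ×ˢ univ))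
    (h4 : D.Countable)
    (h4a : ∀ (n : ℕ), 1 ≤ n → ∀ t ∉ D, ∃ ε > 0, ContDiffOn ℝ n (fun p : ℝ × EuclideanSpace ℝ d => A p.1 p.2) (Icc (t - ε) (t + ε) ×ˢ univ))
    (h4b : ∀ (n : ℕ), 1 ≤ n → ∀ t ∉ D, ∃ ε > 0, ContDiffOn ℝ n (fun p : ℝ × EuclideanSpace ℝ d => (A p.1).symm p.2)
      (Icc (t - ε) (t + ε) ×ˢ univ))
    (h5 : ∀ t ∉ D, ∀ z, HasDerivAt (fun τ => A τ z) (B t (A t z)) t)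
    (h7a : ∀ t z (k : d → ℤ), B t (z + Torus.latticeVec k) = B t z)
    (h7b : ∀ a b : ℝ, ∃ C : ℝ, ∀ t ∈ Icc a b, ∀ z, ‖B t z‖ ≤ C)
    (h7c : ∀ t ∉ D, ∀ z, ContinuousAt (uncurry B) (t, z))
    (h8 : ∀ a b : ℝ, ∃ K : ℝ, ∀ t ∈ Icc a b, ∀ z, ‖fderiv ℝ (A t) z‖ ≤ K)
    (h8' : ∀ a b : ℝ, ∃ K : ℝ, ∀ t ∈ Icc a b, ∀ z, ‖fderiv ℝ (fun y => (A t).symm y) z‖ ≤ K)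
    (v : ℝ → EuclideanSpace ℝ d → EuclideanSpace ℝ d) (hv : IsUniformlyLipschitzOn v univ)
    (hvper : ∀ t z (k : d → ℤ), v t (z + Torus.latticeVec k) = v t z)
    (hvloc : ∀ (n : ℕ), 1 ≤ n → ∀ r, ∃ ε > 0, ContDiffOn ℝ n (uncurry v) (Icc r (r + ε) ×ˢ univ) ∧
      ContDiffOn ℝ n (uncurry v) (Icc (r - ε) r ×ˢ univ))
    (hvbdd : ∃ C : ℝ, ∀ t z, ‖v t z‖ ≤ C)
    (R : ℝ) (hR : 0 < R) :
    ∃ (A' : ℝ → EuclideanSpace ℝ d ≃ EuclideanSpace ℝ d) (D' : Set ℝ),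
    (∀ t z (k : d → ℤ), A' t (z + Torus.latticeVec k) = A' t z + Torus.latticeVec k) ∧
    (∀ (n : ℕ), 1 ≤ n → ∀ r, ∃ ε > 0, ContDiffOn ℝ n (fun p : ℝ × EuclideanSpace ℝ d => A' p.1 p.2) (Icc r (r + ε) ×ˢ univ) ∧
      ContDiffOn ℝ n (fun p : ℝ × EuclideanSpace ℝ d => A' p.1 p.2) (Icc (r - ε) r ×ˢ univ)) ∧
    (∀ (n : ℕ), 1 ≤ n → ∀ r, ∃ ε > 0, ContDiffOn ℝ n (fun p : ℝ × EuclideanSpace ℝ d => (A' p.1).symm p.2) (Icc r (r + ε) ×ˢ univ) ∧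
      ContDiffOn ℝ n (fun p : ℝ × EuclideanSpace ℝ d => (A' p.1).symm p.2) (Icc (r - ε) r ×ˢ univ)) ∧
    D'.Countable ∧
    (∀ (n : ℕ), 1 ≤ n → ∀ t ∉ D', ∃ ε > 0, ContDiffOn ℝ n (fun p : ℝ × EuclideanSpace ℝ d => A' p.1 p.2) (Icc (t - ε) (t + ε) ×ˢ univ)) ∧
    (∀ (n : ℕ), 1 ≤ n → ∀ t ∉ D', ∃ ε > 0, ContDiffOn ℝ n (fun p : ℝ × EuclideanSpace ℝ d => (A' p.1).symm p.2)
      (Icc (t - ε) (t + ε) ×ˢ univ)) ∧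
    (∀ t ∉ D', ∀ z, HasDerivAt (fun τ => A' τ z)
      (B t (A' t z) + fderiv ℝ (fun y => A t ((A ((⌊t / R⌋ : ℝ) * R)).symm y))
        (A ((⌊t / R⌋ : ℝ) * R) ((A t).symm (A' t z))) (v t (A ((⌊t / R⌋ : ℝ) * R) ((A t).symm (A' t z))))) t) ∧
    (∀ t z (k : d → ℤ), (B t (z + Torus.latticeVec k) + fderiv ℝ (fun y => A t ((A ((⌊t / R⌋ : ℝ) * R)).symm y))
        (A ((⌊t / R⌋ : ℝ) * R) ((A t).symm (z + Torus.latticeVec k)))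
        (v t (A ((⌊t / R⌋ : ℝ) * R) ((A t).symm (z + Torus.latticeVec k))))) =
      B t z + fderiv ℝ (fun y => A t ((A ((⌊t / R⌋ : ℝ) * R)).symm y))
        (A ((⌊t / R⌋ : ℝ) * R) ((A t).symm z)) (v t (A ((⌊t / R⌋ : ℝ) * R) ((A t).symm z)))) ∧
    (∀ a b : ℝ, ∃ C : ℝ, ∀ t ∈ Icc a b, ∀ z, ‖B t z + fderiv ℝ (fun y => A t ((A ((⌊t / R⌋ : ℝ) * R)).symm y))
        (A ((⌊t / R⌋ : ℝ) * R) ((A t).symm z)) (v t (A ((⌊t / R⌋ : ℝ) * R) ((A t).symm z)))‖ ≤ C) ∧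
    (∀ t ∉ D', ∀ z, ContinuousAt (uncurry fun t z => B t z + fderiv ℝ (fun y => A t ((A ((⌊t / R⌋ : ℝ) * R)).symm y))
        (A ((⌊t / R⌋ : ℝ) * R) ((A t).symm z)) (v t (A ((⌊t / R⌋ : ℝ) * R) ((A t).symm z)))) (t, z)) ∧
    (∀ a b : ℝ, ∃ K : ℝ, ∀ t ∈ Icc a b, ∀ z, ‖fderiv ℝ (A' t) z‖ ≤ K) ∧
    (∀ a b : ℝ, ∃ K : ℝ, ∀ t ∈ Icc a b, ∀ z, ‖fderiv ℝ (fun y => (A' t).symm y) z‖ ≤ K) := by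
  -- the Eulerian evolution of the new level and the accumulated window maps
  obtain ⟨Z, hZ, hZ'⟩ := exists_flowEquiv hv
  have hZself : ∀ t z, Z t t z = z := fun t z => by rw [hZ, evolutionMap_self]
  obtain ⟨C, hC0, hC⟩ := exists_int_chain fun j : ℤ => (Z (((j : ℝ) + 1) * R) ((j : ℝ) * R)).trans
    ((A ((j : ℝ) * R)).symm.trans (A (((j : ℝ) + 1) * R)))
  -- basic regularity of the factors
  have hAn : ∀ (n : ℕ), 1 ≤ n → ∀ t, ContDiff ℝ n (A t) ∧ ContDiff ℝ n (A t).symm := fun n hn t => by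
    obtain ⟨ε, hε, hR1, -⟩ := h3 n hn t
    obtain ⟨ε', hε', hR2, -⟩ := h3' n hn t
    exact ⟨hR1.comp_contDiff (contDiff_const.prodMk contDiff_id) fun _ => ⟨⟨le_rfl, by linarith⟩, mem_univ _⟩,
      hR2.comp_contDiff (contDiff_const.prodMk contDiff_id) fun _ => ⟨⟨le_rfl, by linarith⟩, mem_univ _⟩⟩
  have hA : ∀ t, ContDiff ℝ 1 (A t) ∧ ContDiff ℝ 1 (A t).symm := fun t => hAn 1 le_rfl t
  have hn' : ∀ {n : ℕ}, 1 ≤ n → (1 : ℕ∞) ≤ (n : ℕ∞) := fun hn => by exact_mod_cast hn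
  have hZcn : ∀ (n : ℕ), 1 ≤ n → ∀ t s, ContDiff ℝ n (Z t s) ∧ ContDiff ℝ n (Z t s).symm := fun n hn t s => by
    constructor
    · have e : ⇑(Z t s) = evolutionMap v s t := funext fun z => hZ t s z
      rw [e]; exact contDiff_evolutionMap_of_local hv (hn' hn) (hvloc n hn) s t
    · have e : ⇑(Z t s).symm = evolutionMap v t s := funext fun z => hZ' t s z
      rw [e]; exact contDiff_evolutionMap_of_local hv (hn' hn) (hvloc n hn) t s
  have hZc : ∀ t s, ContDiff ℝ 1 (Z t s) ∧ ContDiff ℝ 1 (Z t s).symm := hZcn 1 le_rfl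
  have hZeq : ∀ t s z (k : d → ℤ), Z t s (z + Torus.latticeVec k) = Z t s z + Torus.latticeVec k :=
    fun t s z k => by rw [hZ, hZ, evolutionMap_add_latticeVec hv hvper]
  have hMeq : ∀ (j : ℤ) z (k : d → ℤ), ((Z (((j : ℝ) + 1) * R) ((j : ℝ) * R)).trans
      ((A ((j : ℝ) * R)).symm.trans (A (((j : ℝ) + 1) * R)))) (z + Torus.latticeVec k) =
      ((Z (((j : ℝ) + 1) * R) ((j : ℝ) * R)).trans ((A ((j : ℝ) * R)).symm.trans (A (((j : ℝ) + 1) * R)))) z +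
        Torus.latticeVec k :=
    fun j z k => equivariant_trans (hZeq _ _) (equivariant_trans (equivariant_symm (h1 _)) (h1 _)) z k
  have hCeq := equivariant_chain C _ hC0 hC hMeq
  have hCcn : ∀ (n : ℕ), 1 ≤ n → ∀ j : ℤ, ContDiff ℝ n (C j) ∧ ContDiff ℝ n (C j).symm := fun n hn =>
    contDiff_chain_n C _ hC0 hC fun j => contDiff_trans_n (hZcn n hn _ _)
      (contDiff_trans_n (contDiff_symm_n (hAn n hn _)) (hAn n hn _))
  have hCc : ∀ j : ℤ, ContDiff ℝ 1 (C j) ∧ ContDiff ℝ 1 (C j).symm := hCcn 1 le_rfl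
  have hvc : Continuous (uncurry v) := by
    have h := hv.continuousOn_uncurry convex_univ
    rw [univ_prod_univ] at h
    exact continuousOn_univ.1 h
  -- the countable set of times without a two-sided smooth slab of `v`
  have hDv : (⋃ n : ℕ, {t : ℝ | ¬ ∃ ε > 0, ContDiffOn ℝ n (uncurry v) (Icc (t - ε) (t + ε) ×ˢ univ)}).Countable := by
    refine countable_iUnion fun n => countable_not_two_sided fun r => ?_
    obtain ⟨ε, hε, h₁, h₂⟩ := hvloc (max n 1) (le_max_right _ _) r
    have hle : (n : WithTop ℕ∞) ≤ ((max n 1 : ℕ) : WithTop ℕ∞) := by exact_mod_cast le_max_left n 1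
    exact ⟨ε, hε, h₁.of_le hle, h₂.of_le hle⟩
  -- THE NEW ABSOLUTE FLOW
  refine ⟨fun t => (C ⌊t / R⌋).trans ((Z t ((⌊t / R⌋ : ℝ) * R)).trans ((A ((⌊t / R⌋ : ℝ) * R)).symm.trans (A t))),
    D ∪ (⋃ n : ℕ, {t : ℝ | ¬ ∃ ε > 0, ContDiffOn ℝ n (uncurry v) (Icc (t - ε) (t + ε) ×ˢ univ)}) ∪
      {t : ℝ | ∃ j : ℤ, t = (j : ℝ) * R},
    ?_, ?_, ?_, ?_, ?_, ?_, ?_, ?_, ?_, ?_, ?_, ?_⟩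
  · -- lattice equivariance
    intro t z k
    exact equivariant_window_formula A Z (C ⌊t / R⌋) h1 hZeq (hCeq _) _ _ z k
  · -- one-sided slabs of `A'`
    intro n hn r
    obtain ⟨ε₁, hε₁, hr1⟩ := window_formula_eq_right A Z C R hR hZself hC r
    obtain ⟨ε₂, hε₂, hr2⟩ := window_formula_eq_left A Z C R hR hZself hC r
    obtain ⟨ε₃, hε₃, hs1, -, -, -⟩ := exists_slabs_window_formula_n (hn' hn) hv (hvloc n hn) A (h3 n hn) (h3' n hn)
      (hAn n hn) (C ⌊r / R⌋) (hCcn n hn _) ((⌊r / R⌋ : ℝ) * R) r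
    obtain ⟨ε₄, hε₄, -, hs2, -, -⟩ := exists_slabs_window_formula_n (hn' hn) hv (hvloc n hn) A (h3 n hn) (h3' n hn)
      (hAn n hn) (C (⌈r / R⌉ - 1)) (hCcn n hn _) (((⌈r / R⌉ - 1 : ℤ) : ℝ) * R) r
    refine ⟨min (min ε₁ ε₂) (min ε₃ ε₄), lt_min (lt_min hε₁ hε₂) (lt_min hε₃ hε₄), ?_, ?_⟩
    · refine (hs1.mono (prod_mono (Icc_subset_Icc le_rfl (by
        linarith [min_le_right (min ε₁ ε₂) (min ε₃ ε₄), min_le_left ε₃ ε₄])) le_rfl)).congr fun p hp => ?_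
      have hp1 : p.1 ∈ Icc r (r + ε₁) := ⟨hp.1.1, le_trans hp.1.2 (by
        linarith [min_le_left (min ε₁ ε₂) (min ε₃ ε₄), min_le_left ε₁ ε₂])⟩
      rw [hr1 p.1 hp1 p.2]
      exact (window_formula_apply A Z (C ⌊r / R⌋) hZ hZ' p.1 _ p.2).1
    · refine (hs2.mono (prod_mono (Icc_subset_Icc (by
        linarith [min_le_right (min ε₁ ε₂) (min ε₃ ε₄), min_le_right ε₃ ε₄]) le_rfl) le_rfl)).congr fun p hp => ?_
      have hp1 : p.1 ∈ Icc (r - ε₂) r := ⟨le_trans (by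
        linarith [min_le_left (min ε₁ ε₂) (min ε₃ ε₄), min_le_right ε₁ ε₂]) hp.1.1, hp.1.2⟩
      rw [hr2 p.1 hp1 p.2]
      exact (window_formula_apply A Z (C (⌈r / R⌉ - 1)) hZ hZ' p.1 _ p.2).1
  · -- one-sided slabs of the inverses
    intro n hn r
    obtain ⟨ε₁, hε₁, hr1⟩ := window_formula_eq_right A Z C R hR hZself hC r
    obtain ⟨ε₂, hε₂, hr2⟩ := window_formula_eq_left A Z C R hR hZself hC r
    obtain ⟨ε₃, hε₃, -, -, hs1, -⟩ := exists_slabs_window_formula_n (hn' hn) hv (hvloc n hn) A (h3 n hn) (h3' n hn)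
      (hAn n hn) (C ⌊r / R⌋) (hCcn n hn _) ((⌊r / R⌋ : ℝ) * R) r
    obtain ⟨ε₄, hε₄, -, -, -, hs2⟩ := exists_slabs_window_formula_n (hn' hn) hv (hvloc n hn) A (h3 n hn) (h3' n hn)
      (hAn n hn) (C (⌈r / R⌉ - 1)) (hCcn n hn _) (((⌈r / R⌉ - 1 : ℤ) : ℝ) * R) r
    refine ⟨min (min ε₁ ε₂) (min ε₃ ε₄), lt_min (lt_min hε₁ hε₂) (lt_min hε₃ hε₄), ?_, ?_⟩
    · refine (hs1.mono (prod_mono (Icc_subset_Icc le_rfl (by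
        linarith [min_le_right (min ε₁ ε₂) (min ε₃ ε₄), min_le_left ε₃ ε₄])) le_rfl)).congr fun p hp => ?_
      have hp1 : p.1 ∈ Icc r (r + ε₁) := ⟨hp.1.1, le_trans hp.1.2 (by
        linarith [min_le_left (min ε₁ ε₂) (min ε₃ ε₄), min_le_left ε₁ ε₂])⟩
      have hE : (C ⌊p.1 / R⌋).trans ((Z p.1 ((⌊p.1 / R⌋ : ℝ) * R)).trans ((A ((⌊p.1 / R⌋ : ℝ) * R)).symm.trans
          (A p.1))) = (C ⌊r / R⌋).trans ((Z p.1 ((⌊r / R⌋ : ℝ) * R)).trans ((A ((⌊r / R⌋ : ℝ) * R)).symm.trans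
          (A p.1))) := Equiv.ext fun z => hr1 p.1 hp1 z
      simp only []
      rw [hE]
      exact (window_formula_apply A Z (C ⌊r / R⌋) hZ hZ' p.1 _ p.2).2
    · refine (hs2.mono (prod_mono (Icc_subset_Icc (by
        linarith [min_le_right (min ε₁ ε₂) (min ε₃ ε₄), min_le_right ε₃ ε₄]) le_rfl) le_rfl)).congr fun p hp => ?_
      have hp1 : p.1 ∈ Icc (r - ε₂) r := ⟨le_trans (by
        linarith [min_le_left (min ε₁ ε₂) (min ε₃ ε₄), min_le_right ε₁ ε₂]) hp.1.1, hp.1.2⟩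
      have hE : (C ⌊p.1 / R⌋).trans ((Z p.1 ((⌊p.1 / R⌋ : ℝ) * R)).trans ((A ((⌊p.1 / R⌋ : ℝ) * R)).symm.trans
          (A p.1))) = (C (⌈r / R⌉ - 1)).trans ((Z p.1 (((⌈r / R⌉ - 1 : ℤ) : ℝ) * R)).trans
          ((A (((⌈r / R⌉ - 1 : ℤ) : ℝ) * R)).symm.trans (A p.1))) := Equiv.ext fun z => hr2 p.1 hp1 z
      simp only []
      rw [hE]
      exact (window_formula_apply A Z (C (⌈r / R⌉ - 1)) hZ hZ' p.1 _ p.2).2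
  · -- countable break times
    exact (h4.union hDv).union (countable_window_boundaries R)
  · -- two-sided slabs of `A'` off the break times
    intro n hn t ht
    have htD : t ∉ D := fun h => ht (Or.inl (Or.inl h))
    have hvt : ∃ ε > 0, ContDiffOn ℝ n (uncurry v) (Icc (t - ε) (t + ε) ×ˢ univ) := by
      by_contra h; exact ht (Or.inl (Or.inr (mem_iUnion.2 ⟨n, h⟩)))
    have htb : ∀ j : ℤ, t ≠ (j : ℝ) * R := fun j hj => ht (Or.inr ⟨j, hj⟩)
    obtain ⟨ε₁, hε₁, hr1⟩ := window_formula_eq_two_sided A Z C R hR hZself hC (t := t) htb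
    obtain ⟨ε₂, hε₂, hs1, -⟩ := exists_two_sided_slab_window_formula_n (hn' hn) hv (hvloc n hn) A (hAn n hn) (C ⌊t / R⌋)
      (hCcn n hn _) ((⌊t / R⌋ : ℝ) * R) hvt (h4a n hn t htD) (h4b n hn t htD)
    refine ⟨min ε₁ ε₂, lt_min hε₁ hε₂, (hs1.mono (prod_mono (Icc_subset_Icc (by linarith [min_le_right ε₁ ε₂])
      (by linarith [min_le_right ε₁ ε₂])) le_rfl)).congr fun p hp => ?_⟩
    have hp1 : p.1 ∈ Icc (t - ε₁) (t + ε₁) :=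
      ⟨le_trans (by linarith [min_le_left ε₁ ε₂]) hp.1.1, le_trans hp.1.2 (by linarith [min_le_left ε₁ ε₂])⟩
    rw [hr1 p.1 hp1 p.2]
    exact (window_formula_apply A Z (C ⌊t / R⌋) hZ hZ' p.1 _ p.2).1
  · -- two-sided slabs of the inverses off the break times
    intro n hn t ht
    have htD : t ∉ D := fun h => ht (Or.inl (Or.inl h))
    have hvt : ∃ ε > 0, ContDiffOn ℝ n (uncurry v) (Icc (t - ε) (t + ε) ×ˢ univ) := by
      by_contra h; exact ht (Or.inl (Or.inr (mem_iUnion.2 ⟨n, h⟩)))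
    have htb : ∀ j : ℤ, t ≠ (j : ℝ) * R := fun j hj => ht (Or.inr ⟨j, hj⟩)
    obtain ⟨ε₁, hε₁, hr1⟩ := window_formula_eq_two_sided A Z C R hR hZself hC (t := t) htb
    obtain ⟨ε₂, hε₂, -, hs1⟩ := exists_two_sided_slab_window_formula_n (hn' hn) hv (hvloc n hn) A (hAn n hn) (C ⌊t / R⌋)
      (hCcn n hn _) ((⌊t / R⌋ : ℝ) * R) hvt (h4a n hn t htD) (h4b n hn t htD)
    refine ⟨min ε₁ ε₂, lt_min hε₁ hε₂, (hs1.mono (prod_mono (Icc_subset_Icc (by linarith [min_le_right ε₁ ε₂])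
      (by linarith [min_le_right ε₁ ε₂])) le_rfl)).congr fun p hp => ?_⟩
    have hp1 : p.1 ∈ Icc (t - ε₁) (t + ε₁) :=
      ⟨le_trans (by linarith [min_le_left ε₁ ε₂]) hp.1.1, le_trans hp.1.2 (by linarith [min_le_left ε₁ ε₂])⟩
    have hE : (C ⌊p.1 / R⌋).trans ((Z p.1 ((⌊p.1 / R⌋ : ℝ) * R)).trans ((A ((⌊p.1 / R⌋ : ℝ) * R)).symm.trans
        (A p.1))) = (C ⌊t / R⌋).trans ((Z p.1 ((⌊t / R⌋ : ℝ) * R)).trans ((A ((⌊t / R⌋ : ℝ) * R)).symm.trans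
        (A p.1))) := Equiv.ext fun z => hr1 p.1 hp1 z
    simp only []
    rw [hE]
    exact (window_formula_apply A Z (C ⌊t / R⌋) hZ hZ' p.1 _ p.2).2
  · -- the flow equation off the break times
    intro t ht z
    have htD : t ∉ D := fun h => ht (Or.inl (Or.inl h))
    have htb : ∀ j : ℤ, t ≠ (j : ℝ) * R := fun j hj => ht (Or.inr ⟨j, hj⟩)
    obtain ⟨ε₁, hε₁, hr1⟩ := window_formula_eq_two_sided A Z C R hR hZself hC (t := t) htb
    set s : ℝ := (⌊t / R⌋ : ℝ) * R with hs
    have hder := hasDerivAt_window_formula hv A B s (C ⌊t / R⌋) z (h4a 1 le_rfl t htD) (h5 t htD) (hA t).1 (hA s).2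
    -- the value of `A' t z` and of the frame point
    have hP : ((C ⌊t / R⌋).trans ((Z t s).trans ((A s).symm.trans (A t)))) z =
        A t ((A s).symm (evolutionMap v s t (C ⌊t / R⌋ z))) := (window_formula_apply A Z (C ⌊t / R⌋) hZ hZ' t s z).1
    have hq : A s ((A t).symm (((C ⌊t / R⌋).trans ((Z t s).trans ((A s).symm.trans (A t)))) z)) =
        evolutionMap v s t (C ⌊t / R⌋ z) := by
      rw [hP]; simp
    simp only []
    rw [hq, hP]
    refine hder.congr_of_eventuallyEq ?_
    filter_upwards [Icc_mem_nhds (show t - ε₁ < t by linarith) (show t < t + ε₁ by linarith)] with τ hτ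
    rw [hr1 τ hτ z]
    exact (window_formula_apply A Z (C ⌊t / R⌋) hZ hZ' τ s z).1
  · -- periodicity of the new velocity
    intro t z k
    rw [h7a, inserted_add_latticeVec A v t _ h1 hvper]
  · -- local boundedness of the new velocity
    intro a b
    obtain ⟨C₀, hC₀⟩ := h7b a b
    obtain ⟨K₁, hK₁⟩ := h8 a b
    obtain ⟨K₂, hK₂⟩ := h8' (a - R) b
    obtain ⟨Cv, hCv⟩ := hvbdd
    refine ⟨C₀ + max K₁ 0 * max K₂ 0 * max Cv 0, fun t ht z => ?_⟩
    have hsI : (⌊t / R⌋ : ℝ) * R ∈ Icc (a - R) b := by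
      obtain ⟨h1', h2'⟩ := floor_window hR t
      exact ⟨by nlinarith [ht.1], le_trans h1' ht.2⟩
    have hb := norm_inserted_le A t ((⌊t / R⌋ : ℝ) * R) (hA t).1 (hA _).2
      (K₁ := max K₁ 0) (K₂ := max K₂ 0) (fun y => (hK₁ t ht y).trans (le_max_left _ _))
      (fun y => (hK₂ _ hsI y).trans (le_max_left _ _)) (le_max_right _ _)
      (A ((⌊t / R⌋ : ℝ) * R) ((A t).symm z)) (v t (A ((⌊t / R⌋ : ℝ) * R) ((A t).symm z)))
    calc _ ≤ ‖B t z‖ + ‖fderiv ℝ (fun y => A t ((A ((⌊t / R⌋ : ℝ) * R)).symm y)) (A ((⌊t / R⌋ : ℝ) * R) ((A t).symm z))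
          (v t (A ((⌊t / R⌋ : ℝ) * R) ((A t).symm z)))‖ := norm_add_le _ _
      _ ≤ C₀ + max K₁ 0 * max K₂ 0 * ‖v t (A ((⌊t / R⌋ : ℝ) * R) ((A t).symm z))‖ := add_le_add (hC₀ t ht z) hb
      _ ≤ C₀ + max K₁ 0 * max K₂ 0 * max Cv 0 := by
          have : ‖v t (A ((⌊t / R⌋ : ℝ) * R) ((A t).symm z))‖ ≤ max Cv 0 := (hCv _ _).trans (le_max_left _ _)
          have h0 : 0 ≤ max K₁ 0 * max K₂ 0 := mul_nonneg (le_max_right _ _) (le_max_right _ _)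
          nlinarith
  · -- joint continuity of the new velocity off the break times
    intro t ht z
    have htD : t ∉ D := fun h => ht (Or.inl (Or.inl h))
    have htb : ∀ j : ℤ, t ≠ (j : ℝ) * R := fun j hj => ht (Or.inr ⟨j, hj⟩)
    obtain ⟨ε₁, hε₁, hsub⟩ := exists_Icc_subset_Ioo_window hR (t := t) htb
    have hB := h7c t htD z
    have hI := continuousAt_inserted A v ((⌊t / R⌋ : ℝ) * R) z (h4a 1 le_rfl t htD) (h4b 1 le_rfl t htD)
      (fun τ => (hA τ).1) (hA _).2 hvc
    refine (hB.add hI).congr ?_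
    have hnhds : Icc (t - ε₁) (t + ε₁) ×ˢ (univ : Set (EuclideanSpace ℝ d)) ∈ 𝓝 (t, z) :=
      prod_mem_nhds (Icc_mem_nhds (by linarith) (by linarith)) univ_mem
    filter_upwards [hnhds] with p hp
    have hfl : ⌊p.1 / R⌋ = ⌊t / R⌋ := floor_eq_of_mem_Ico hR (Ioo_subset_Ico_self (hsub hp.1))
    simp only [Pi.add_apply, uncurry, hfl]
  · -- derivative bounds for `A'` on compact time ranges
    intro a b
    obtain ⟨K₁, hK₁⟩ := h8 a b
    obtain ⟨K₂, hK₂⟩ := h8' (a - R) b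
    obtain ⟨K₃, hK₃0, hK₃⟩ := exists_bound_fderiv_evolutionMap_Icc hv (a - R) b
    choose KC hKC using fun j : ℤ => exists_bound_fderiv_of_equivariant (hCc j).1 (hCeq j)
    refine ⟨max K₁ 0 * max K₂ 0 * K₃ * ∑ j ∈ Finset.Icc ⌊a / R⌋ ⌊b / R⌋, max (KC j) 0, fun t ht z => ?_⟩
    have hsI : (⌊t / R⌋ : ℝ) * R ∈ Icc (a - R) b := by
      obtain ⟨h1', h2'⟩ := floor_window hR t
      exact ⟨by nlinarith [ht.1], le_trans h1' ht.2⟩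
    have htI : t ∈ Icc (a - R) b := ⟨by linarith [ht.1], ht.2⟩
    have hjI : ⌊t / R⌋ ∈ Finset.Icc ⌊a / R⌋ ⌊b / R⌋ := by
      rw [Finset.mem_Icc]
      exact ⟨Int.floor_le_floor (div_le_div_of_nonneg_right ht.1 hR.le),
        Int.floor_le_floor (div_le_div_of_nonneg_right ht.2 hR.le)⟩
    have hKC' : ∀ y, ‖fderiv ℝ (C ⌊t / R⌋) y‖ ≤ ∑ j ∈ Finset.Icc ⌊a / R⌋ ⌊b / R⌋, max (KC j) 0 := fun y =>
      ((hKC _ y).trans (le_max_left _ 0)).trans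
        (Finset.single_le_sum (f := fun j => max (KC j) 0) (fun j _ => le_max_right _ _) hjI)
    have e : ⇑((C ⌊t / R⌋).trans ((Z t ((⌊t / R⌋ : ℝ) * R)).trans ((A ((⌊t / R⌋ : ℝ) * R)).symm.trans (A t)))) =
        fun y => A t ((A ((⌊t / R⌋ : ℝ) * R)).symm (evolutionMap v ((⌊t / R⌋ : ℝ) * R) t (C ⌊t / R⌋ y))) :=
      funext fun y => (window_formula_apply A Z (C ⌊t / R⌋) hZ hZ' t _ y).1
    simp only []
    rw [e]
    exact norm_fderiv_comp4_le (A t) (A ((⌊t / R⌋ : ℝ) * R)).symm (evolutionMap v ((⌊t / R⌋ : ℝ) * R) t)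
      (C ⌊t / R⌋) (hA t).1 (hA _).2 (contDiff_evolutionMap_of_local hv le_rfl (hvloc 1 le_rfl) _ _) (hCc _).1
      (fun y => (hK₁ t ht y).trans (le_max_left _ _)) (fun y => (hK₂ _ hsI y).trans (le_max_left _ _))
      (fun y => hK₃ _ hsI _ htI y) hKC' (le_max_right _ _) (le_max_right _ _) hK₃0 z
  · -- derivative bounds for the inverses
    intro a b
    obtain ⟨K₁, hK₁⟩ := h8' a b
    obtain ⟨K₂, hK₂⟩ := h8 (a - R) b
    obtain ⟨K₃, hK₃0, hK₃⟩ := exists_bound_fderiv_evolutionMap_Icc hv (a - R) b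
    choose KC hKC using fun j : ℤ => exists_bound_fderiv_of_equivariant (hCc j).2 (equivariant_symm (hCeq j))
    refine ⟨(∑ j ∈ Finset.Icc ⌊a / R⌋ ⌊b / R⌋, max (KC j) 0) * K₃ * max K₂ 0 * max K₁ 0, fun t ht z => ?_⟩
    have hsI : (⌊t / R⌋ : ℝ) * R ∈ Icc (a - R) b := by
      obtain ⟨h1', h2'⟩ := floor_window hR t
      exact ⟨by nlinarith [ht.1], le_trans h1' ht.2⟩
    have htI : t ∈ Icc (a - R) b := ⟨by linarith [ht.1], ht.2⟩
    have hjI : ⌊t / R⌋ ∈ Finset.Icc ⌊a / R⌋ ⌊b / R⌋ := by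
      rw [Finset.mem_Icc]
      exact ⟨Int.floor_le_floor (div_le_div_of_nonneg_right ht.1 hR.le),
        Int.floor_le_floor (div_le_div_of_nonneg_right ht.2 hR.le)⟩
    have hKC' : ∀ y, ‖fderiv ℝ (C ⌊t / R⌋).symm y‖ ≤ ∑ j ∈ Finset.Icc ⌊a / R⌋ ⌊b / R⌋, max (KC j) 0 := fun y =>
      ((hKC _ y).trans (le_max_left _ 0)).trans
        (Finset.single_le_sum (f := fun j => max (KC j) 0) (fun j _ => le_max_right _ _) hjI)
    have e : (fun y => ((C ⌊t / R⌋).trans ((Z t ((⌊t / R⌋ : ℝ) * R)).trans ((A ((⌊t / R⌋ : ℝ) * R)).symm.trans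
        (A t)))).symm y) =
        fun y => (C ⌊t / R⌋).symm (evolutionMap v t ((⌊t / R⌋ : ℝ) * R) (A ((⌊t / R⌋ : ℝ) * R) ((A t).symm y))) :=
      funext fun y => (window_formula_apply A Z (C ⌊t / R⌋) hZ hZ' t _ y).2
    simp only []
    rw [e]
    have hsum0 : 0 ≤ ∑ j ∈ Finset.Icc ⌊a / R⌋ ⌊b / R⌋, max (KC j) 0 :=
      Finset.sum_nonneg fun j _ => le_max_right _ _
    exact norm_fderiv_comp4_le (C ⌊t / R⌋).symm (evolutionMap v t ((⌊t / R⌋ : ℝ) * R)) (A ((⌊t / R⌋ : ℝ) * R))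
      (fun y => (A t).symm y) (hCc _).2 (contDiff_evolutionMap_of_local hv le_rfl (hvloc 1 le_rfl) _ _) (hA _).1 (hA t).2
      hKC' (fun y => hK₃ _ htI _ hsI y) (fun y => (hK₂ _ hsI y).trans (le_max_left _ _))
      (fun y => (hK₁ t ht y).trans (le_max_left _ _)) hsum0 hK₃0 (le_max_right _ _) z

end Step

end Summit.AnomalousDissipation.AnomalousDissipation.Theorems.SolenoidalFractalHomogenisation.LagrangianCarrierConstruction

end
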